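import Literature.Computability.Cryptography.GoldreichLevinProgram
import Literature.Computability.Cryptography.GoldreichLevinFinal
import HarnessLib

/-!
# The Goldreich–Levin theorem for hiding functions, fixed output length: discharge

Discharge of the named fact `goldreichLevin_hiding_len` (`GoldreichLevinHidingLen.lean`;
Y. Liu, R. Pass, FOCS 2020, Appendix A, Thm [GL89] for `𝒮`-hiding functions; O. Goldreich,
*Foundations of Cryptography I*, Thm 2.5.6): the tree's machine-level proof is assembled from

* `GLFin.goldreichLevin_hiding_len_of_polyTime` (`GoldreichLevinFinal.lean`): the theorem from the
  efficiency of the Goldreich–Levin inverter `𝒜_GL` (`GLInv.alg`; success probability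
  `GLInv.hidingProb_ge`, XOR lemma `GLPred.xorLemma_pointwise`, Rackoff's pairwise independent
  list decoding `goldreich_levin_core`, advice-carrying coin budget on a sparse sequence of good
  levels), and
* `GLInv.glInvRun_polyTime_holds` (`GoldreichLevinProgram.lean`): `𝒜_GL` runs in polynomial time
  (the `FP` program around the calls of the distinguisher).

This file only composes the two (it cannot live in `GoldreichLevinHidingLen.lean` itself, which
both proofs import).

## References

* O. Goldreich, L. A. Levin, *A hard-core predicate for all one-way functions*, STOC 1989, 25–32.
* O. Goldreich, *Foundations of Cryptography I*, CUP 2001, §2.5.2–2.5.3, Thm 2.5.6.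
* Y. Liu, R. Pass, *On one-way functions and Kolmogorov complexity*, FOCS 2020
  (arXiv:2009.11514), Appendix A ("Hardcore functions and the Goldreich–Levin Theorem":
  Def. of `𝒮`-hiding, Thm [GL89] "also see Theorem 2.12 in [HHR06]").
-/

namespace Literature.Computability.Cryptography

/-- **The Goldreich–Levin theorem for hiding functions, `O(log n)` bits, fixed output length**
(discharge of the named fact `goldreichLevin_hiding_len`): for every family `𝒮 = {S_n ⊆ {0,1}ⁿ}`
of eventually nonempty sets, every randomized `g(x ‖ ρ)` (`|ρ| = m(n)`) of fixed output length
`ℓ_g(n)` on the seeds of level `n`, and every `d`, if `g` is `𝒮`-hiding then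
`{g(x‖ρ) ‖ σ ‖ GL_{d⌊log₂ n⌋}(x, σ)}` and `{g(x‖ρ) ‖ σ ‖ U_{d⌊log₂ n⌋}}` are computationally
indistinguishable. Composition of `GLFin.goldreichLevin_hiding_len_of_polyTime` with
`GLInv.glInvRun_polyTime_holds`. [O. Goldreich, L. Levin, STOC 1989; Goldreich 2001, Thm 2.5.6;
Y. Liu, R. Pass, FOCS 2020 (arXiv:2009.11514), Appendix A, Thm [GL89]]
[cite: LiuPassFOCS2020, Appendix (Thm [GL89], hardcore functions for S-hiding f)] -/
theorem goldreichLevin_hiding_len_holds : goldreichLevin_hiding_len :=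
  GLFin.goldreichLevin_hiding_len_of_polyTime GLInv.glInvRun_polyTime_holds

end Literature.Computability.Cryptography
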